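import Summits.QuantumFields.YangMills.Theorems.BalabanUVNodesSpineReadingOfRecord13CoPH
import Summits.QuantumFields.YangMills.Theorems.BalabanUVNodesSpineReadingOfRecord13CoPHV
import Summits.QuantumFields.YangMills.Theorems.BalabanUVNodesN21DilationRoadAtRecord13CoPH

/-!
# YM-DAG node N21 (= NE7c) · THE DILATION ROAD AT dag-n20-d's SPINE READING OF RECORD `YMDAG.UVSplit.crOfRecord₁₃At K₀ jcut sh` (∕ `crOfRecord₁₃ jcut sh`):
# p583987's per-tuple dilation package at the reading's OWN carriers `(1, classSet₁₃ θ K₀ g₀, weightA₁₃ …, weightB₁₃ …, (sh …).1, (sh …).2)` ⇒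
# `ShellWeightBound … (crOfRecord₁₃At …).Wsh` with NO domination clause (the reading's weight slot IS the canonical `wshInf`, dag-n20-d
# `shellWeightBound_crOfRecord₁₃At` BY NAME) ⇒ the K3-skeleton ∕ leaf-D `KeyedShellWeight` ∕ `h21` binder shapes, `S_N21 (SRec₁₃CoPH (crOfRecord₁₃At …))`
# (∕ `…CoPHOn … Rg`) AT THE READING OF RECORD — route-independent (no Theses import); the item-facing leaf is the companion `…LeafF`

Track A of `YM-PLAN.md` (cell `pub-ymgap`, HUMAN RULING D-0062 ∕ D-0149 width seats), node **N21**; WIDTH SEAT `pub-ymgap-dag-n21-w2` (gen 0),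
W-SEAT-START-LIST v4 §n21 ITEM 2 «`KeyedShellWeight cr` (leaf D's h21) AT THE RECORD … — at parameter `cr` until `crOfRecord₁₃` lands (§0)»: this is the
rewrite AT `crOfRecord₁₃` (plan g78 l.24332, dag-n20-c (iii) l.24188, dag-n20-d WORD-CR13 l.24470∕l.24693), file 5 of this seat.  THEOREMS ONLY: 0 `def`, 0 `sorry`,
standard axioms; COUNT-NEUTRAL; `--kind proof --supports stmt-QuantumFields-20544 --as helper`.  Imports dag-n20-d's FILE B `…SpineReadingOfRecord13CoPH` (`crOfRecord₁₃At`,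
`ShellSplit₁₃CoPH`, the dictionary, ★ `shellWeightBound_crOfRecord₁₃At`; brings FILE A `…SpineCanonicalWeights`: `wshInf`, `shellWeightBound_wshInf`) and my file 1 p583987 ONLY — NO
Theses import (restate-immune, outside the theses cone, importable by the socket ∕ composer pens); the item-facing instance (`N = 2`, leaf E at the reading) is the
terminal companion `…N27SpineGivenEndpointR13SepCoPHDilationRoadAtReading` (leaf F).  Restates nothing; cites by name.  The `ShellWeightBound`-⟺-term-bounds SOCKET at the
reading is dag-n20-w1's (`…N21KeyedShellWeightSocket`, its INTENT-2 §3) — NOT typed here (WORD-SOCKET l.24932).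

WHAT IS PROVED ([bookkeeping]; `N`-generic; every step ONE application BY NAME).
* §1 ★★ `shellWeightBound_crOfRecord₁₃At_of_dilationLevels` — ONE TUPLE: the dilation ∃-package (p583987 §2's hypothesis, slot data over the key type
  `Σ K, SiteSeqKey F (K₀+K)`) at the reading's carriers ⇒ NE7c's `ShellWeightBound` AT THE READING, its own weight slot (`exists_shellWeight_of_dilationLevels` +
  dag-n20-d `shellWeightBound_crOfRecord₁₃At`).
* §2 at every tuple: ★★ `keyedShellWeight_crOfRecord₁₃At_of_dilationLevels` (the K3 skeleton's `KeyedShellWeight (crOfRecord₁₃At K₀ jcut sh)` shape — `∀` admissible Stage-13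
  tuples with provisos, NO domination clause) · ★ `shellWeightBound_guarded_crOfRecord₁₃At_of_dilationLevels` (leaf D's `h21` at `cr := crOfRecord₁₃At …` on a regime `Rg`) ·
  `s_N21_sRec₁₃CoPH_crOfRecord₁₃At_of_dilationLevels` ∕ `s_N21_sRec₁₃CoPHOn_crOfRecord₁₃At_of_dilationLevels` (the K5 stub at the (T-SPINE)₁₃ homes of the reading;
  `s_N21_sRec₁₃CoPH_iff` ∕ dag-n19-d `s_N21_sRec₁₃CoPHOn_iff` BY NAME).

* §3 (v1.1, APPEND-ONLY) THE V EDITION: the same five faces AT dag-n20-d's volume-re-pinned reading `crOfRecord₁₃VAt K₀ jcut sh` (`vol := F.side ^ 4`,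
  `…SpineReadingOfRecord13CoPHV`, the K3⁷ v3 pointer of record) — `…_crOfRecord₁₃VAt_of_dilationLevels` ×5, via `shellWeightBound_crOfRecord₁₃VAt` BY NAME (the shell face
  is volume-blind; carriers `T∕A∕B∕shA∕shB∕Wsh` are v1.0's by `rfl`).

HONEST FRAMING (binding).  NOT a discharge: the dilation package (two `LevelLedger`s over the σ-packed keys — (M1) per level NOT PRINTED + [dict] — `LiveWindow`s,
polynomial multiplier ∕ block-dimension letters, widths) is a HYPOTHESIS at every tuple, and the SHELL SPLIT `sh : ShellSplit₁₃CoPH N K₀` is dag-n20-d's DISPLAYED residual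
reading (NODE O's ∕ N21's object — NOT inhabited); `jcut` displayed; no inhabitant of any admissible Stage-13 tuple with provisos claimed (K0⁷ OPEN); nothing of Bałaban's
asserted; NE7 ∕ NE7b ∕ NE7c NOT PRINTED for d = 4 and NOT PROVED; **N21 NOT discharged**, N27 NOT discharged, K3⁷ NOT claimed; counts UNMOVED (typed 28∕28 · discharged 5∕27);
one finite four-torus programme at fixed `ε` — NOT ℝ⁴, NOT infinite volume, NOT OS, NOT a mass gap, NOT Clay.  No decl below carries a cite tag.
-/

set_option autoImplicit false

open Finset

namespace Summit.QuantumFields.YangMills.Theorems.N21DilationRoadAtRecord13CoPH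

open Literature.MathematicalPhysics.QuantumFieldTheory.Balaban1983to89
open Literature.MathematicalPhysics.QuantumFieldTheory.Balaban1983to89.T4Continuum
open Literature.MathematicalPhysics.QuantumFieldTheory.Balaban1983to89.Node00
open T4WeightBudget (RelWeightBound)
open T4IndicatorShell (ShellWeightBound)
open T4ShellMeasureLevels (LevelLedger LiveWindow)
open Summit.QuantumFields.BalabanUV.T4Continuum.Spine
open YMDAG.UVSplit
open Summit.QuantumFields.YangMills.BalabanUVNodes.N19TargetAtHomes13CoPHOn (s_N21_sRec₁₃CoPHOn_iff)

/-! ## §1 One tuple: the dilation package at the reading's carriers ⇒ NE7c AT THE READING (own weight slot) -/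

section OneTuple

variable {F : T4Family} {N : ℕ} [NeZero N] (K₀ : ℕ) (jcut : ℕ → ℕ) (sh : ShellSplit₁₃CoPH N K₀) (θ : Stage13HParams F N)
  (hP : θ.Provisos₁₃CoPH F N) (g₀ : ℕ → ℝ) (os : List (ULoop F))

/-- ★★ **THE DILATION ROAD AT THE READING OF RECORD, ONE TUPLE.**  If the reading's carriers at `(F, θ, hP, g₀, os)` — source window `1`, the keyed
class set `classSet₁₃ θ K₀ g₀`, run-A ∕ run-B fibre sums `weightA₁₃ ∕ weightB₁₃ θ hP K₀ g₀ os`, the displayed shell split `(sh …).1 ∕ .2` — carry p583987's dilation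
∃-package (two `LevelLedger`s with constants `M_j·3(d_j+1)∕(1−ρ_j)` in `LiveWindow`s, polynomial `M, d`, widths `≤ ½` at a geometric rate), then NE7c's
`ShellWeightBound` holds AT THE READING `crOfRecord₁₃At K₀ jcut sh F θ hP g₀ os` with ITS OWN weight slot (the canonical `wshInf`) — NO domination clause
(`exists_shellWeight_of_dilationLevels` + dag-n20-d `shellWeightBound_crOfRecord₁₃At` BY NAME).  HYPOTHESES only; NE7c NOT proved. [bookkeeping] -/
theorem shellWeightBound_crOfRecord₁₃At_of_dilationLevels
    (h : ∃ (σA σB : Type) (SA : ℕ → Finset σA) (SB : ℕ → Finset σB) (pieceA : ℕ → ℝ → σA → (Σ K, SiteSeqKey F (K₀ + K)) → ℝ)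
      (pieceB : ℕ → ℝ → σB → (Σ K, SiteSeqKey F (K₀ + K)) → ℝ) (lvlA : ℕ → σA → ℕ) (lvlB : ℕ → σB → ℕ) (MA dA ρA MB dB ρB : ℕ → ℝ)
      (N₁ : ℕ) (νbar Mbar d₀ c₁ ϑ : ℝ) (p q : ℕ),
      LevelLedger 1 (classSet₁₃ θ K₀ g₀) (weightA₁₃ θ hP K₀ g₀ os) (sh F θ hP g₀ os).1 SA pieceA lvlA (fun j => MA j * (3 * (dA j + 1) / (1 - ρA j))) ρA ∧
      LevelLedger 1 (classSet₁₃ θ K₀ g₀) (weightB₁₃ θ hP K₀ g₀ os) (sh F θ hP g₀ os).2 SB pieceB lvlB (fun j => MB j * (3 * (dB j + 1) / (1 - ρB j))) ρB ∧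
      LiveWindow SA lvlA N₁ νbar ∧ LiveWindow SB lvlB N₁ νbar ∧ 0 ≤ ϑ ∧ ϑ < 1 ∧
      (∀ j, 0 ≤ MA j) ∧ (∀ j, MA j ≤ Mbar * ((j : ℝ) ^ q + 1)) ∧ (∀ j, 0 ≤ MB j) ∧ (∀ j, MB j ≤ Mbar * ((j : ℝ) ^ q + 1)) ∧
      (∀ j, 0 ≤ dA j) ∧ (∀ j, dA j ≤ d₀ * ((j : ℝ) ^ p + 1)) ∧ (∀ j, 0 ≤ dB j) ∧ (∀ j, dB j ≤ d₀ * ((j : ℝ) ^ p + 1)) ∧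
      (∀ j, ρA j ≤ 1 / 2) ∧ (∀ j, ρA j ≤ c₁ * ϑ ^ j) ∧ (∀ j, ρB j ≤ 1 / 2) ∧ (∀ j, ρB j ≤ c₁ * ϑ ^ j)) :
    ShellWeightBound (crOfRecord₁₃At K₀ jcut sh F θ hP g₀ os).l₀ (crOfRecord₁₃At K₀ jcut sh F θ hP g₀ os).T (crOfRecord₁₃At K₀ jcut sh F θ hP g₀ os).A
      (crOfRecord₁₃At K₀ jcut sh F θ hP g₀ os).B (crOfRecord₁₃At K₀ jcut sh F θ hP g₀ os).shA (crOfRecord₁₃At K₀ jcut sh F θ hP g₀ os).shB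
      (crOfRecord₁₃At K₀ jcut sh F θ hP g₀ os).Wsh := by
  obtain ⟨Wsh, hW⟩ := exists_shellWeight_of_dilationLevels (crOfRecord₁₃At K₀ jcut sh F θ hP g₀ os) h
  exact shellWeightBound_crOfRecord₁₃At K₀ jcut sh θ hP g₀ os hW

end OneTuple

/-! ## §2 Every tuple: `KeyedShellWeight` ∕ leaf D's `h21` ∕ the K5 stub AT THE READING OF RECORD -/

section Keyed

variable {N : ℕ} [NeZero N] (K₀ : ℕ) (jcut : ℕ → ℕ) (sh : ShellSplit₁₃CoPH N K₀) (Rg : (F : T4Family) → Stage13HParams F N → Prop)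

/-- ★★ **`KeyedShellWeight (crOfRecord₁₃At K₀ jcut sh)` FROM THE DILATION ROAD** (the K3 skeleton's N21 conjunct of `stub_expansion13` AT dag-n20-d's reading, up to
the proviso edition `Provisos₁₃SepCoPH.toCore`): at every admissible Stage-13 tuple with provisos and every `(g₀, os)`, the dilation ∃-package at the reading's carriers
⇒ `ShellWeightBound` at the reading with its own weight slot — NO domination clause, NO summability clause on the slot (§1 per tuple).  NOT a discharge. [bookkeeping] -/
theorem keyedShellWeight_crOfRecord₁₃At_of_dilationLevels
    (hread : ∀ (F : T4Family) (θ : Stage13HParams F N) (hP : θ.Provisos₁₃CoPH F N), θ.Admissible F N → ∀ (g₀ : ℕ → ℝ) (os : List (ULoop F)),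
      ∃ (σA σB : Type) (SA : ℕ → Finset σA) (SB : ℕ → Finset σB) (pieceA : ℕ → ℝ → σA → (Σ K, SiteSeqKey F (K₀ + K)) → ℝ)
        (pieceB : ℕ → ℝ → σB → (Σ K, SiteSeqKey F (K₀ + K)) → ℝ) (lvlA : ℕ → σA → ℕ) (lvlB : ℕ → σB → ℕ) (MA dA ρA MB dB ρB : ℕ → ℝ)
        (N₁ : ℕ) (νbar Mbar d₀ c₁ ϑ : ℝ) (p q : ℕ),
        LevelLedger 1 (classSet₁₃ θ K₀ g₀) (weightA₁₃ θ hP K₀ g₀ os) (sh F θ hP g₀ os).1 SA pieceA lvlA (fun j => MA j * (3 * (dA j + 1) / (1 - ρA j))) ρA ∧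
        LevelLedger 1 (classSet₁₃ θ K₀ g₀) (weightB₁₃ θ hP K₀ g₀ os) (sh F θ hP g₀ os).2 SB pieceB lvlB (fun j => MB j * (3 * (dB j + 1) / (1 - ρB j))) ρB ∧
        LiveWindow SA lvlA N₁ νbar ∧ LiveWindow SB lvlB N₁ νbar ∧ 0 ≤ ϑ ∧ ϑ < 1 ∧
        (∀ j, 0 ≤ MA j) ∧ (∀ j, MA j ≤ Mbar * ((j : ℝ) ^ q + 1)) ∧ (∀ j, 0 ≤ MB j) ∧ (∀ j, MB j ≤ Mbar * ((j : ℝ) ^ q + 1)) ∧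
        (∀ j, 0 ≤ dA j) ∧ (∀ j, dA j ≤ d₀ * ((j : ℝ) ^ p + 1)) ∧ (∀ j, 0 ≤ dB j) ∧ (∀ j, dB j ≤ d₀ * ((j : ℝ) ^ p + 1)) ∧
        (∀ j, ρA j ≤ 1 / 2) ∧ (∀ j, ρA j ≤ c₁ * ϑ ^ j) ∧ (∀ j, ρB j ≤ 1 / 2) ∧ (∀ j, ρB j ≤ c₁ * ϑ ^ j))
    (F : T4Family) (θ : Stage13HParams F N) (hP : θ.Provisos₁₃CoPH F N) (hθ : θ.Admissible F N) (g₀ : ℕ → ℝ) (os : List (ULoop F)) :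
    letI S := crOfRecord₁₃At K₀ jcut sh F θ hP g₀ os
    ShellWeightBound S.l₀ S.T S.A S.B S.shA S.shB S.Wsh :=
  shellWeightBound_crOfRecord₁₃At_of_dilationLevels K₀ jcut sh θ hP g₀ os (hread F θ hP hθ g₀ os)

/-- ★ **LEAF D's GUARDED `h21` AT `cr := crOfRecord₁₃At K₀ jcut sh` FROM THE DILATION ROAD** (regime `Rg`; at `Rg F θ := θ.ZhUnity F N ∧ θ.SlotsNondegenerate₁₃ F N`, `N = 2`,
this is VERBATIM the `h21` of leaf D ∕ leaf E ∕ n27-c's `keyedGuarded₁₃CoPH_of_keyedFacesP` at the reading).  NOT a discharge. [bookkeeping] -/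
theorem shellWeightBound_guarded_crOfRecord₁₃At_of_dilationLevels
    (hread : ∀ (F : T4Family) (θ : Stage13HParams F N) (hP : θ.Provisos₁₃CoPH F N), Rg F θ → θ.Admissible F N → ∀ (g₀ : ℕ → ℝ) (os : List (ULoop F)),
      ∃ (σA σB : Type) (SA : ℕ → Finset σA) (SB : ℕ → Finset σB) (pieceA : ℕ → ℝ → σA → (Σ K, SiteSeqKey F (K₀ + K)) → ℝ)
        (pieceB : ℕ → ℝ → σB → (Σ K, SiteSeqKey F (K₀ + K)) → ℝ) (lvlA : ℕ → σA → ℕ) (lvlB : ℕ → σB → ℕ) (MA dA ρA MB dB ρB : ℕ → ℝ)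
        (N₁ : ℕ) (νbar Mbar d₀ c₁ ϑ : ℝ) (p q : ℕ),
        LevelLedger 1 (classSet₁₃ θ K₀ g₀) (weightA₁₃ θ hP K₀ g₀ os) (sh F θ hP g₀ os).1 SA pieceA lvlA (fun j => MA j * (3 * (dA j + 1) / (1 - ρA j))) ρA ∧
        LevelLedger 1 (classSet₁₃ θ K₀ g₀) (weightB₁₃ θ hP K₀ g₀ os) (sh F θ hP g₀ os).2 SB pieceB lvlB (fun j => MB j * (3 * (dB j + 1) / (1 - ρB j))) ρB ∧
        LiveWindow SA lvlA N₁ νbar ∧ LiveWindow SB lvlB N₁ νbar ∧ 0 ≤ ϑ ∧ ϑ < 1 ∧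
        (∀ j, 0 ≤ MA j) ∧ (∀ j, MA j ≤ Mbar * ((j : ℝ) ^ q + 1)) ∧ (∀ j, 0 ≤ MB j) ∧ (∀ j, MB j ≤ Mbar * ((j : ℝ) ^ q + 1)) ∧
        (∀ j, 0 ≤ dA j) ∧ (∀ j, dA j ≤ d₀ * ((j : ℝ) ^ p + 1)) ∧ (∀ j, 0 ≤ dB j) ∧ (∀ j, dB j ≤ d₀ * ((j : ℝ) ^ p + 1)) ∧
        (∀ j, ρA j ≤ 1 / 2) ∧ (∀ j, ρA j ≤ c₁ * ϑ ^ j) ∧ (∀ j, ρB j ≤ 1 / 2) ∧ (∀ j, ρB j ≤ c₁ * ϑ ^ j))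
    (F : T4Family) (θ : Stage13HParams F N) (hP : θ.Provisos₁₃CoPH F N) (hRg : Rg F θ) (hθ : θ.Admissible F N) (g₀ : ℕ → ℝ)
    (os : List (ULoop F)) :
    letI S := crOfRecord₁₃At K₀ jcut sh F θ hP g₀ os
    ShellWeightBound S.l₀ S.T S.A S.B S.shA S.shB S.Wsh :=
  shellWeightBound_crOfRecord₁₃At_of_dilationLevels K₀ jcut sh θ hP g₀ os (hread F θ hP hRg hθ g₀ os)

/-- **THE K5 STUB AT THE (T-SPINE)₁₃ HOME OF THE READING**: `S_N21 (SRec₁₃CoPH (crOfRecord₁₃At K₀ jcut sh))` from the dilation package at every admissible tuple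
(`s_N21_sRec₁₃CoPH_iff` BY NAME).  NOT a discharge. [bookkeeping] -/
theorem s_N21_sRec₁₃CoPH_crOfRecord₁₃At_of_dilationLevels
    (hread : ∀ (F : T4Family) (θ : Stage13HParams F N) (hP : θ.Provisos₁₃CoPH F N), θ.Admissible F N → ∀ (g₀ : ℕ → ℝ) (os : List (ULoop F)),
      ∃ (σA σB : Type) (SA : ℕ → Finset σA) (SB : ℕ → Finset σB) (pieceA : ℕ → ℝ → σA → (Σ K, SiteSeqKey F (K₀ + K)) → ℝ)
        (pieceB : ℕ → ℝ → σB → (Σ K, SiteSeqKey F (K₀ + K)) → ℝ) (lvlA : ℕ → σA → ℕ) (lvlB : ℕ → σB → ℕ) (MA dA ρA MB dB ρB : ℕ → ℝ)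
        (N₁ : ℕ) (νbar Mbar d₀ c₁ ϑ : ℝ) (p q : ℕ),
        LevelLedger 1 (classSet₁₃ θ K₀ g₀) (weightA₁₃ θ hP K₀ g₀ os) (sh F θ hP g₀ os).1 SA pieceA lvlA (fun j => MA j * (3 * (dA j + 1) / (1 - ρA j))) ρA ∧
        LevelLedger 1 (classSet₁₃ θ K₀ g₀) (weightB₁₃ θ hP K₀ g₀ os) (sh F θ hP g₀ os).2 SB pieceB lvlB (fun j => MB j * (3 * (dB j + 1) / (1 - ρB j))) ρB ∧
        LiveWindow SA lvlA N₁ νbar ∧ LiveWindow SB lvlB N₁ νbar ∧ 0 ≤ ϑ ∧ ϑ < 1 ∧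
        (∀ j, 0 ≤ MA j) ∧ (∀ j, MA j ≤ Mbar * ((j : ℝ) ^ q + 1)) ∧ (∀ j, 0 ≤ MB j) ∧ (∀ j, MB j ≤ Mbar * ((j : ℝ) ^ q + 1)) ∧
        (∀ j, 0 ≤ dA j) ∧ (∀ j, dA j ≤ d₀ * ((j : ℝ) ^ p + 1)) ∧ (∀ j, 0 ≤ dB j) ∧ (∀ j, dB j ≤ d₀ * ((j : ℝ) ^ p + 1)) ∧
        (∀ j, ρA j ≤ 1 / 2) ∧ (∀ j, ρA j ≤ c₁ * ϑ ^ j) ∧ (∀ j, ρB j ≤ 1 / 2) ∧ (∀ j, ρB j ≤ c₁ * ϑ ^ j)) :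
    S_N21 (SRec₁₃CoPH (crOfRecord₁₃At K₀ jcut sh)) :=
  (s_N21_sRec₁₃CoPH_iff _).2 (keyedShellWeight_crOfRecord₁₃At_of_dilationLevels K₀ jcut sh hread)

/-- **… AND AT THE REGIME HOME**: `S_N21 (SRec₁₃CoPHOn (crOfRecord₁₃At K₀ jcut sh) Rg)` from the dilation package at every admissible tuple IN THE REGIME (dag-n19-d
`s_N21_sRec₁₃CoPHOn_iff` BY NAME).  NOT a discharge. [bookkeeping] -/
theorem s_N21_sRec₁₃CoPHOn_crOfRecord₁₃At_of_dilationLevels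
    (hread : ∀ (F : T4Family) (θ : Stage13HParams F N) (hP : θ.Provisos₁₃CoPH F N), Rg F θ → θ.Admissible F N → ∀ (g₀ : ℕ → ℝ) (os : List (ULoop F)),
      ∃ (σA σB : Type) (SA : ℕ → Finset σA) (SB : ℕ → Finset σB) (pieceA : ℕ → ℝ → σA → (Σ K, SiteSeqKey F (K₀ + K)) → ℝ)
        (pieceB : ℕ → ℝ → σB → (Σ K, SiteSeqKey F (K₀ + K)) → ℝ) (lvlA : ℕ → σA → ℕ) (lvlB : ℕ → σB → ℕ) (MA dA ρA MB dB ρB : ℕ → ℝ)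
        (N₁ : ℕ) (νbar Mbar d₀ c₁ ϑ : ℝ) (p q : ℕ),
        LevelLedger 1 (classSet₁₃ θ K₀ g₀) (weightA₁₃ θ hP K₀ g₀ os) (sh F θ hP g₀ os).1 SA pieceA lvlA (fun j => MA j * (3 * (dA j + 1) / (1 - ρA j))) ρA ∧
        LevelLedger 1 (classSet₁₃ θ K₀ g₀) (weightB₁₃ θ hP K₀ g₀ os) (sh F θ hP g₀ os).2 SB pieceB lvlB (fun j => MB j * (3 * (dB j + 1) / (1 - ρB j))) ρB ∧
        LiveWindow SA lvlA N₁ νbar ∧ LiveWindow SB lvlB N₁ νbar ∧ 0 ≤ ϑ ∧ ϑ < 1 ∧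
        (∀ j, 0 ≤ MA j) ∧ (∀ j, MA j ≤ Mbar * ((j : ℝ) ^ q + 1)) ∧ (∀ j, 0 ≤ MB j) ∧ (∀ j, MB j ≤ Mbar * ((j : ℝ) ^ q + 1)) ∧
        (∀ j, 0 ≤ dA j) ∧ (∀ j, dA j ≤ d₀ * ((j : ℝ) ^ p + 1)) ∧ (∀ j, 0 ≤ dB j) ∧ (∀ j, dB j ≤ d₀ * ((j : ℝ) ^ p + 1)) ∧
        (∀ j, ρA j ≤ 1 / 2) ∧ (∀ j, ρA j ≤ c₁ * ϑ ^ j) ∧ (∀ j, ρB j ≤ 1 / 2) ∧ (∀ j, ρB j ≤ c₁ * ϑ ^ j)) :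
    S_N21 (SRec₁₃CoPHOn (crOfRecord₁₃At K₀ jcut sh) Rg) :=
  (s_N21_sRec₁₃CoPHOn_iff _ Rg).2 (shellWeightBound_guarded_crOfRecord₁₃At_of_dilationLevels K₀ jcut sh Rg hread)

end Keyed

/-! ## §3 (v1.1) THE V EDITION `crOfRecord₁₃VAt` (`vol := F.side ^ 4`): one tuple -/

section OneTupleV

variable {F : T4Family} {N : ℕ} [NeZero N] (K₀ : ℕ) (jcut : ℕ → ℕ) (sh : ShellSplit₁₃CoPH N K₀) (θ : Stage13HParams F N)
  (hP : θ.Provisos₁₃CoPH F N) (g₀ : ℕ → ℝ) (os : List (ULoop F))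

/-- ★★ **THE DILATION ROAD AT THE READING OF RECORD, ONE TUPLE.**  If the reading's carriers at `(F, θ, hP, g₀, os)` — source window `1`, the keyed
class set `classSet₁₃ θ K₀ g₀`, run-A ∕ run-B fibre sums `weightA₁₃ ∕ weightB₁₃ θ hP K₀ g₀ os`, the displayed shell split `(sh …).1 ∕ .2` — carry p583987's dilation
∃-package (two `LevelLedger`s with constants `M_j·3(d_j+1)∕(1−ρ_j)` in `LiveWindow`s, polynomial `M, d`, widths `≤ ½` at a geometric rate), then NE7c's
`ShellWeightBound` holds AT THE READING `crOfRecord₁₃VAt K₀ jcut sh F θ hP g₀ os` with ITS OWN weight slot (the canonical `wshInf`) — NO domination clause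
(`exists_shellWeight_of_dilationLevels` + dag-n20-d `shellWeightBound_crOfRecord₁₃VAt` BY NAME).  HYPOTHESES only; NE7c NOT proved. [bookkeeping] -/
theorem shellWeightBound_crOfRecord₁₃VAt_of_dilationLevels
    (h : ∃ (σA σB : Type) (SA : ℕ → Finset σA) (SB : ℕ → Finset σB) (pieceA : ℕ → ℝ → σA → (Σ K, SiteSeqKey F (K₀ + K)) → ℝ)
      (pieceB : ℕ → ℝ → σB → (Σ K, SiteSeqKey F (K₀ + K)) → ℝ) (lvlA : ℕ → σA → ℕ) (lvlB : ℕ → σB → ℕ) (MA dA ρA MB dB ρB : ℕ → ℝ)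
      (N₁ : ℕ) (νbar Mbar d₀ c₁ ϑ : ℝ) (p q : ℕ),
      LevelLedger 1 (classSet₁₃ θ K₀ g₀) (weightA₁₃ θ hP K₀ g₀ os) (sh F θ hP g₀ os).1 SA pieceA lvlA (fun j => MA j * (3 * (dA j + 1) / (1 - ρA j))) ρA ∧
      LevelLedger 1 (classSet₁₃ θ K₀ g₀) (weightB₁₃ θ hP K₀ g₀ os) (sh F θ hP g₀ os).2 SB pieceB lvlB (fun j => MB j * (3 * (dB j + 1) / (1 - ρB j))) ρB ∧
      LiveWindow SA lvlA N₁ νbar ∧ LiveWindow SB lvlB N₁ νbar ∧ 0 ≤ ϑ ∧ ϑ < 1 ∧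
      (∀ j, 0 ≤ MA j) ∧ (∀ j, MA j ≤ Mbar * ((j : ℝ) ^ q + 1)) ∧ (∀ j, 0 ≤ MB j) ∧ (∀ j, MB j ≤ Mbar * ((j : ℝ) ^ q + 1)) ∧
      (∀ j, 0 ≤ dA j) ∧ (∀ j, dA j ≤ d₀ * ((j : ℝ) ^ p + 1)) ∧ (∀ j, 0 ≤ dB j) ∧ (∀ j, dB j ≤ d₀ * ((j : ℝ) ^ p + 1)) ∧
      (∀ j, ρA j ≤ 1 / 2) ∧ (∀ j, ρA j ≤ c₁ * ϑ ^ j) ∧ (∀ j, ρB j ≤ 1 / 2) ∧ (∀ j, ρB j ≤ c₁ * ϑ ^ j)) :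
    ShellWeightBound (crOfRecord₁₃VAt K₀ jcut sh F θ hP g₀ os).l₀ (crOfRecord₁₃VAt K₀ jcut sh F θ hP g₀ os).T (crOfRecord₁₃VAt K₀ jcut sh F θ hP g₀ os).A
      (crOfRecord₁₃VAt K₀ jcut sh F θ hP g₀ os).B (crOfRecord₁₃VAt K₀ jcut sh F θ hP g₀ os).shA (crOfRecord₁₃VAt K₀ jcut sh F θ hP g₀ os).shB
      (crOfRecord₁₃VAt K₀ jcut sh F θ hP g₀ os).Wsh := by
  obtain ⟨Wsh, hW⟩ := exists_shellWeight_of_dilationLevels (crOfRecord₁₃VAt K₀ jcut sh F θ hP g₀ os) h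
  exact shellWeightBound_crOfRecord₁₃VAt K₀ jcut sh θ hP g₀ os hW

end OneTupleV

/-! ### §3b (v1.1) THE V EDITION: every tuple -/

section KeyedV

variable {N : ℕ} [NeZero N] (K₀ : ℕ) (jcut : ℕ → ℕ) (sh : ShellSplit₁₃CoPH N K₀) (Rg : (F : T4Family) → Stage13HParams F N → Prop)

/-- ★★ **`KeyedShellWeight (crOfRecord₁₃VAt K₀ jcut sh)` FROM THE DILATION ROAD** (the K3 skeleton's N21 conjunct of `stub_expansion13` AT dag-n20-d's reading, up to
the proviso edition `Provisos₁₃SepCoPH.toCore`): at every admissible Stage-13 tuple with provisos and every `(g₀, os)`, the dilation ∃-package at the reading's carriers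
⇒ `ShellWeightBound` at the reading with its own weight slot — NO domination clause, NO summability clause on the slot (§1 per tuple).  NOT a discharge. [bookkeeping] -/
theorem keyedShellWeight_crOfRecord₁₃VAt_of_dilationLevels
    (hread : ∀ (F : T4Family) (θ : Stage13HParams F N) (hP : θ.Provisos₁₃CoPH F N), θ.Admissible F N → ∀ (g₀ : ℕ → ℝ) (os : List (ULoop F)),
      ∃ (σA σB : Type) (SA : ℕ → Finset σA) (SB : ℕ → Finset σB) (pieceA : ℕ → ℝ → σA → (Σ K, SiteSeqKey F (K₀ + K)) → ℝ)
        (pieceB : ℕ → ℝ → σB → (Σ K, SiteSeqKey F (K₀ + K)) → ℝ) (lvlA : ℕ → σA → ℕ) (lvlB : ℕ → σB → ℕ) (MA dA ρA MB dB ρB : ℕ → ℝ)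
        (N₁ : ℕ) (νbar Mbar d₀ c₁ ϑ : ℝ) (p q : ℕ),
        LevelLedger 1 (classSet₁₃ θ K₀ g₀) (weightA₁₃ θ hP K₀ g₀ os) (sh F θ hP g₀ os).1 SA pieceA lvlA (fun j => MA j * (3 * (dA j + 1) / (1 - ρA j))) ρA ∧
        LevelLedger 1 (classSet₁₃ θ K₀ g₀) (weightB₁₃ θ hP K₀ g₀ os) (sh F θ hP g₀ os).2 SB pieceB lvlB (fun j => MB j * (3 * (dB j + 1) / (1 - ρB j))) ρB ∧
        LiveWindow SA lvlA N₁ νbar ∧ LiveWindow SB lvlB N₁ νbar ∧ 0 ≤ ϑ ∧ ϑ < 1 ∧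
        (∀ j, 0 ≤ MA j) ∧ (∀ j, MA j ≤ Mbar * ((j : ℝ) ^ q + 1)) ∧ (∀ j, 0 ≤ MB j) ∧ (∀ j, MB j ≤ Mbar * ((j : ℝ) ^ q + 1)) ∧
        (∀ j, 0 ≤ dA j) ∧ (∀ j, dA j ≤ d₀ * ((j : ℝ) ^ p + 1)) ∧ (∀ j, 0 ≤ dB j) ∧ (∀ j, dB j ≤ d₀ * ((j : ℝ) ^ p + 1)) ∧
        (∀ j, ρA j ≤ 1 / 2) ∧ (∀ j, ρA j ≤ c₁ * ϑ ^ j) ∧ (∀ j, ρB j ≤ 1 / 2) ∧ (∀ j, ρB j ≤ c₁ * ϑ ^ j))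
    (F : T4Family) (θ : Stage13HParams F N) (hP : θ.Provisos₁₃CoPH F N) (hθ : θ.Admissible F N) (g₀ : ℕ → ℝ) (os : List (ULoop F)) :
    letI S := crOfRecord₁₃VAt K₀ jcut sh F θ hP g₀ os
    ShellWeightBound S.l₀ S.T S.A S.B S.shA S.shB S.Wsh :=
  shellWeightBound_crOfRecord₁₃VAt_of_dilationLevels K₀ jcut sh θ hP g₀ os (hread F θ hP hθ g₀ os)

/-- ★ **LEAF D's GUARDED `h21` AT `cr := crOfRecord₁₃VAt K₀ jcut sh` FROM THE DILATION ROAD** (regime `Rg`; at `Rg F θ := θ.ZhUnity F N ∧ θ.SlotsNondegenerate₁₃ F N`, `N = 2`,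
this is VERBATIM the `h21` of leaf D ∕ leaf E ∕ n27-c's `keyedGuarded₁₃CoPH_of_keyedFacesP` at the reading).  NOT a discharge. [bookkeeping] -/
theorem shellWeightBound_guarded_crOfRecord₁₃VAt_of_dilationLevels
    (hread : ∀ (F : T4Family) (θ : Stage13HParams F N) (hP : θ.Provisos₁₃CoPH F N), Rg F θ → θ.Admissible F N → ∀ (g₀ : ℕ → ℝ) (os : List (ULoop F)),
      ∃ (σA σB : Type) (SA : ℕ → Finset σA) (SB : ℕ → Finset σB) (pieceA : ℕ → ℝ → σA → (Σ K, SiteSeqKey F (K₀ + K)) → ℝ)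
        (pieceB : ℕ → ℝ → σB → (Σ K, SiteSeqKey F (K₀ + K)) → ℝ) (lvlA : ℕ → σA → ℕ) (lvlB : ℕ → σB → ℕ) (MA dA ρA MB dB ρB : ℕ → ℝ)
        (N₁ : ℕ) (νbar Mbar d₀ c₁ ϑ : ℝ) (p q : ℕ),
        LevelLedger 1 (classSet₁₃ θ K₀ g₀) (weightA₁₃ θ hP K₀ g₀ os) (sh F θ hP g₀ os).1 SA pieceA lvlA (fun j => MA j * (3 * (dA j + 1) / (1 - ρA j))) ρA ∧
        LevelLedger 1 (classSet₁₃ θ K₀ g₀) (weightB₁₃ θ hP K₀ g₀ os) (sh F θ hP g₀ os).2 SB pieceB lvlB (fun j => MB j * (3 * (dB j + 1) / (1 - ρB j))) ρB ∧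
        LiveWindow SA lvlA N₁ νbar ∧ LiveWindow SB lvlB N₁ νbar ∧ 0 ≤ ϑ ∧ ϑ < 1 ∧
        (∀ j, 0 ≤ MA j) ∧ (∀ j, MA j ≤ Mbar * ((j : ℝ) ^ q + 1)) ∧ (∀ j, 0 ≤ MB j) ∧ (∀ j, MB j ≤ Mbar * ((j : ℝ) ^ q + 1)) ∧
        (∀ j, 0 ≤ dA j) ∧ (∀ j, dA j ≤ d₀ * ((j : ℝ) ^ p + 1)) ∧ (∀ j, 0 ≤ dB j) ∧ (∀ j, dB j ≤ d₀ * ((j : ℝ) ^ p + 1)) ∧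
        (∀ j, ρA j ≤ 1 / 2) ∧ (∀ j, ρA j ≤ c₁ * ϑ ^ j) ∧ (∀ j, ρB j ≤ 1 / 2) ∧ (∀ j, ρB j ≤ c₁ * ϑ ^ j))
    (F : T4Family) (θ : Stage13HParams F N) (hP : θ.Provisos₁₃CoPH F N) (hRg : Rg F θ) (hθ : θ.Admissible F N) (g₀ : ℕ → ℝ)
    (os : List (ULoop F)) :
    letI S := crOfRecord₁₃VAt K₀ jcut sh F θ hP g₀ os
    ShellWeightBound S.l₀ S.T S.A S.B S.shA S.shB S.Wsh :=
  shellWeightBound_crOfRecord₁₃VAt_of_dilationLevels K₀ jcut sh θ hP g₀ os (hread F θ hP hRg hθ g₀ os)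

/-- **THE K5 STUB AT THE (T-SPINE)₁₃ HOME OF THE READING**: `S_N21 (SRec₁₃CoPH (crOfRecord₁₃VAt K₀ jcut sh))` from the dilation package at every admissible tuple
(`s_N21_sRec₁₃CoPH_iff` BY NAME).  NOT a discharge. [bookkeeping] -/
theorem s_N21_sRec₁₃CoPH_crOfRecord₁₃VAt_of_dilationLevels
    (hread : ∀ (F : T4Family) (θ : Stage13HParams F N) (hP : θ.Provisos₁₃CoPH F N), θ.Admissible F N → ∀ (g₀ : ℕ → ℝ) (os : List (ULoop F)),
      ∃ (σA σB : Type) (SA : ℕ → Finset σA) (SB : ℕ → Finset σB) (pieceA : ℕ → ℝ → σA → (Σ K, SiteSeqKey F (K₀ + K)) → ℝ)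
        (pieceB : ℕ → ℝ → σB → (Σ K, SiteSeqKey F (K₀ + K)) → ℝ) (lvlA : ℕ → σA → ℕ) (lvlB : ℕ → σB → ℕ) (MA dA ρA MB dB ρB : ℕ → ℝ)
        (N₁ : ℕ) (νbar Mbar d₀ c₁ ϑ : ℝ) (p q : ℕ),
        LevelLedger 1 (classSet₁₃ θ K₀ g₀) (weightA₁₃ θ hP K₀ g₀ os) (sh F θ hP g₀ os).1 SA pieceA lvlA (fun j => MA j * (3 * (dA j + 1) / (1 - ρA j))) ρA ∧
        LevelLedger 1 (classSet₁₃ θ K₀ g₀) (weightB₁₃ θ hP K₀ g₀ os) (sh F θ hP g₀ os).2 SB pieceB lvlB (fun j => MB j * (3 * (dB j + 1) / (1 - ρB j))) ρB ∧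
        LiveWindow SA lvlA N₁ νbar ∧ LiveWindow SB lvlB N₁ νbar ∧ 0 ≤ ϑ ∧ ϑ < 1 ∧
        (∀ j, 0 ≤ MA j) ∧ (∀ j, MA j ≤ Mbar * ((j : ℝ) ^ q + 1)) ∧ (∀ j, 0 ≤ MB j) ∧ (∀ j, MB j ≤ Mbar * ((j : ℝ) ^ q + 1)) ∧
        (∀ j, 0 ≤ dA j) ∧ (∀ j, dA j ≤ d₀ * ((j : ℝ) ^ p + 1)) ∧ (∀ j, 0 ≤ dB j) ∧ (∀ j, dB j ≤ d₀ * ((j : ℝ) ^ p + 1)) ∧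
        (∀ j, ρA j ≤ 1 / 2) ∧ (∀ j, ρA j ≤ c₁ * ϑ ^ j) ∧ (∀ j, ρB j ≤ 1 / 2) ∧ (∀ j, ρB j ≤ c₁ * ϑ ^ j)) :
    S_N21 (SRec₁₃CoPH (crOfRecord₁₃VAt K₀ jcut sh)) :=
  (s_N21_sRec₁₃CoPH_iff _).2 (keyedShellWeight_crOfRecord₁₃VAt_of_dilationLevels K₀ jcut sh hread)

/-- **… AND AT THE REGIME HOME**: `S_N21 (SRec₁₃CoPHOn (crOfRecord₁₃VAt K₀ jcut sh) Rg)` from the dilation package at every admissible tuple IN THE REGIME (dag-n19-d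
`s_N21_sRec₁₃CoPHOn_iff` BY NAME).  NOT a discharge. [bookkeeping] -/
theorem s_N21_sRec₁₃CoPHOn_crOfRecord₁₃VAt_of_dilationLevels
    (hread : ∀ (F : T4Family) (θ : Stage13HParams F N) (hP : θ.Provisos₁₃CoPH F N), Rg F θ → θ.Admissible F N → ∀ (g₀ : ℕ → ℝ) (os : List (ULoop F)),
      ∃ (σA σB : Type) (SA : ℕ → Finset σA) (SB : ℕ → Finset σB) (pieceA : ℕ → ℝ → σA → (Σ K, SiteSeqKey F (K₀ + K)) → ℝ)
        (pieceB : ℕ → ℝ → σB → (Σ K, SiteSeqKey F (K₀ + K)) → ℝ) (lvlA : ℕ → σA → ℕ) (lvlB : ℕ → σB → ℕ) (MA dA ρA MB dB ρB : ℕ → ℝ)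
        (N₁ : ℕ) (νbar Mbar d₀ c₁ ϑ : ℝ) (p q : ℕ),
        LevelLedger 1 (classSet₁₃ θ K₀ g₀) (weightA₁₃ θ hP K₀ g₀ os) (sh F θ hP g₀ os).1 SA pieceA lvlA (fun j => MA j * (3 * (dA j + 1) / (1 - ρA j))) ρA ∧
        LevelLedger 1 (classSet₁₃ θ K₀ g₀) (weightB₁₃ θ hP K₀ g₀ os) (sh F θ hP g₀ os).2 SB pieceB lvlB (fun j => MB j * (3 * (dB j + 1) / (1 - ρB j))) ρB ∧
        LiveWindow SA lvlA N₁ νbar ∧ LiveWindow SB lvlB N₁ νbar ∧ 0 ≤ ϑ ∧ ϑ < 1 ∧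
        (∀ j, 0 ≤ MA j) ∧ (∀ j, MA j ≤ Mbar * ((j : ℝ) ^ q + 1)) ∧ (∀ j, 0 ≤ MB j) ∧ (∀ j, MB j ≤ Mbar * ((j : ℝ) ^ q + 1)) ∧
        (∀ j, 0 ≤ dA j) ∧ (∀ j, dA j ≤ d₀ * ((j : ℝ) ^ p + 1)) ∧ (∀ j, 0 ≤ dB j) ∧ (∀ j, dB j ≤ d₀ * ((j : ℝ) ^ p + 1)) ∧
        (∀ j, ρA j ≤ 1 / 2) ∧ (∀ j, ρA j ≤ c₁ * ϑ ^ j) ∧ (∀ j, ρB j ≤ 1 / 2) ∧ (∀ j, ρB j ≤ c₁ * ϑ ^ j)) :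
    S_N21 (SRec₁₃CoPHOn (crOfRecord₁₃VAt K₀ jcut sh) Rg) :=
  (s_N21_sRec₁₃CoPHOn_iff _ Rg).2 (shellWeightBound_guarded_crOfRecord₁₃VAt_of_dilationLevels K₀ jcut sh Rg hread)

end KeyedV

end Summit.QuantumFields.YangMills.Theorems.N21DilationRoadAtRecord13CoPH
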